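import Mathlib
import Summits.MatrixMultiplication.MatrixMultiplication.Theorems.SnSubsetDichotomyHyperoctahedralThresholdTwinSupplyCSCyclic
import Summits.MatrixMultiplication.MatrixMultiplication.Theorems.SnSubsetDichotomyHyperoctahedralThresholdSameColourTip

/-!
# Clean-pair atom — vocabulary of the depth recursion (definitions) (`SnSubsetDichotomy.HyperoctahedralThreshold`, stmt-10883)

Route-posited objects for the line `Lines/stub_plan_poorRigidCore.md` (proof plan `work/ATOM_PROOF.md` of the stub-plan
prover seat, crux `Cruxes/HyperoctahedralThreshold/`).  Three fixed-point-free involutions `μ_c` on `Fin n`; colour words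
act on the right (`TwinSupplyCS.act`).  A ROOT is `p : Bool → Fin n` (two distinct points), a STRAND of depth `d` is a
reduced word `β` of length `d`; its slot `(σ, t)` sits at `pos μ p β σ t = (p σ)·β.take t`, and its rung at time `t` is the
pair of the two sides.  We define

* `Near μ r y y'` — some colour word of length `≤ r` carries `y` to `y'` (graph distance `≤ r`);
* `Avoids μ F p β` — both trajectories avoid `F` at all times `≤ |β|`;
* `Separated μ r p β` — no two slots are `Near r`, except same-side slots at most `r` apart in time;
* `Defect μ p β β' s t` — the rung of `β` at time `s` and the rung of `β'` at time `t` share a point with a mismatch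
  on the other side (for rungs with distinct endpoints this is exactly "share exactly one point", i.e. NOT
  equal / swapped / disjoint);
* `Inv μ F r p d S` — the LEVEL INVARIANT of the recursion: distinct root points; every member of the finset `S` is a
  reduced word of length `d`, `F`-avoiding and `r`-separated; all members end in the same cell (both sides); and `S`
  is TOTALLY DIRTY (every two distinct members have a defect).

Only definitions and their unfolding lemmas live here (review lane, D-0009); the counting lives in the sibling files.
-/

-- the tree's namespace `Summit.MatrixMultiplication.MatrixMultiplication.…` repeats a component by design
set_option linter.dupNamespace false

namespace Summit.MatrixMultiplication.MatrixMultiplication.Theorems.HyperoctahedralThreshold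

namespace CleanPair

open TwinSupplyCS

variable {n : ℕ}

/-- `Near μ r y y'`: some colour word of length at most `r` carries `y` to `y'`. -/
def Near (μ : Fin 3 → Equiv.Perm (Fin n)) (r : ℕ) (y y' : Fin n) : Prop :=
  ∃ w : List (Fin 3), w.length ≤ r ∧ act μ y w = y'

/-- Position of the strand `β` from the root `p` on side `σ` at time `t`: `(p σ) · β.take t`. -/
def pos (μ : Fin 3 → Equiv.Perm (Fin n)) (p : Bool → Fin n) (β : List (Fin 3)) (σ : Bool) (t : ℕ) : Fin n :=
  act μ (p σ) (β.take t)

/-- The strand `β` from `p` avoids `F`: both trajectories stay outside `F` at all times `t ≤ |β|`. -/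
def Avoids (μ : Fin 3 → Equiv.Perm (Fin n)) (F : Finset (Fin n)) (p : Bool → Fin n) (β : List (Fin 3)) : Prop :=
  ∀ σ : Bool, ∀ t ≤ β.length, pos μ p β σ t ∉ F

/-- The strand `β` from `p` is `r`-SEPARATED: two slots `(σ,t) ≠ (σ',t')` are never `r`-near, unless they lie on the
same side at most `r` apart in time. -/
def Separated (μ : Fin 3 → Equiv.Perm (Fin n)) (r : ℕ) (p : Bool → Fin n) (β : List (Fin 3)) : Prop :=
  ∀ σ σ' : Bool, ∀ t t' : ℕ, t ≤ β.length → t' ≤ β.length → (σ ≠ σ' ∨ t + r < t' ∨ t' + r < t) →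
    ¬ Near μ r (pos μ p β σ t) (pos μ p β σ' t')

/-- Mutual DEFECT of `β` at time `s` against `β'` at time `t`: the two rungs share a point, with a mismatch on the
other side. -/
def Defect (μ : Fin 3 → Equiv.Perm (Fin n)) (p : Bool → Fin n) (β β' : List (Fin 3)) (s t : ℕ) : Prop :=
  ∃ σ σ' : Bool, pos μ p β σ s = pos μ p β' σ' t ∧ pos μ p β (!σ) s ≠ pos μ p β' (!σ') t

/-- The LEVEL INVARIANT of the depth recursion (see the module docstring). -/
def Inv (μ : Fin 3 → Equiv.Perm (Fin n)) (F : Finset (Fin n)) (r : ℕ) (p : Bool → Fin n) (d : ℕ)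
    (S : Finset (List (Fin 3))) : Prop :=
  p false ≠ p true ∧
  (∀ β ∈ S, β.length = d ∧ List.IsChain (· ≠ ·) β ∧ Avoids μ F p β ∧ Separated μ r p β) ∧
  (∀ β ∈ S, ∀ β' ∈ S, ∀ σ : Bool, pos μ p β σ d = pos μ p β' σ d) ∧
  (∀ β ∈ S, ∀ β' ∈ S, β ≠ β' → ∃ s ≤ d, ∃ t ≤ d, Defect μ p β β' s t)

/-! ### Unfolding lemmas -/

/-- `Near` is reflexive. -/
theorem Near.rfl {μ : Fin 3 → Equiv.Perm (Fin n)} {r : ℕ} {y : Fin n} : Near μ r y y :=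
  ⟨[], by simp, by simp [act]⟩

/-- `Near` along a word: `y` is `|w|`-near `y · w`. -/
theorem near_act (μ : Fin 3 → Equiv.Perm (Fin n)) (y : Fin n) (w : List (Fin 3)) {r : ℕ} (h : w.length ≤ r) :
    Near μ r y (act μ y w) :=
  ⟨w, h, rfl⟩

/-- `Near` is symmetric (letters are involutions: read the word backwards). -/
theorem Near.symm {μ : Fin 3 → Equiv.Perm (Fin n)} (hμ : ∀ c, μ c * μ c = 1) {r : ℕ} {y y' : Fin n}
    (h : Near μ r y y') : Near μ r y' y := by
  obtain ⟨w, hw, rfl⟩ := h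
  exact ⟨w.reverse, by simpa using hw, act_act_reverse μ (involutive_of_mul_self μ hμ) w y⟩

/-- `Near` is monotone in the radius. -/
theorem Near.mono {μ : Fin 3 → Equiv.Perm (Fin n)} {r r' : ℕ} (hr : r ≤ r') {y y' : Fin n} (h : Near μ r y y') :
    Near μ r' y y' := by
  obtain ⟨w, hw, e⟩ := h
  exact ⟨w, hw.trans hr, e⟩

/-- `Near` composes (radii add). -/
theorem Near.trans {μ : Fin 3 → Equiv.Perm (Fin n)} {r r' : ℕ} {y y' y'' : Fin n} (h : Near μ r y y')
    (h' : Near μ r' y' y'') : Near μ (r + r') y y'' := by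
  obtain ⟨w, hw, rfl⟩ := h
  obtain ⟨w', hw', rfl⟩ := h'
  exact ⟨w ++ w', by simp; omega, act_append μ y w w'⟩

/-- The position at time `0` is the root point. -/
theorem pos_zero (μ : Fin 3 → Equiv.Perm (Fin n)) (p : Bool → Fin n) (β : List (Fin 3)) (σ : Bool) :
    pos μ p β σ 0 = p σ := by
  simp [pos, act]

/-- The position at the final time is the endpoint of the whole word. -/
theorem pos_length (μ : Fin 3 → Equiv.Perm (Fin n)) (p : Bool → Fin n) (β : List (Fin 3)) (σ : Bool) :
    pos μ p β σ β.length = act μ (p σ) β := by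
  simp [pos]

/-- Consecutive positions are joined by one letter, hence positions `t ≤ t'` are `(t'-t)`-near. [this line] -/
theorem near_pos_pos (μ : Fin 3 → Equiv.Perm (Fin n)) (p : Bool → Fin n) (β : List (Fin 3)) (σ : Bool) {t t' : ℕ}
    (htt : t ≤ t') : Near μ (t' - t) (pos μ p β σ t) (pos μ p β σ t') := by
  refine ⟨(β.take t').drop t, by simp; omega, ?_⟩
  rw [pos, pos, ← act_append]
  congr 1
  conv_rhs => rw [← List.take_append_drop t (β.take t')]
  rw [List.take_take, Nat.min_eq_left htt]

/-- A defect is symmetric (swap the two strands and the two times). -/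
theorem Defect.symm {μ : Fin 3 → Equiv.Perm (Fin n)} {p : Bool → Fin n} {β β' : List (Fin 3)} {s t : ℕ}
    (h : Defect μ p β β' s t) : Defect μ p β' β t s := by
  obtain ⟨σ, σ', h1, h2⟩ := h
  exact ⟨σ', σ, h1.symm, fun e => h2 e.symm⟩

/-! ### Positions under restriction and reversal -/

/-- Positions of a suffix strand: dropping a prefix of length `t'` re-roots at the rung of time `t'` and shifts time. -/
theorem pos_drop (μ : Fin 3 → Equiv.Perm (Fin n)) (p : Bool → Fin n) (β : List (Fin 3)) (σ : Bool) (t' t : ℕ) :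
    pos μ (fun τ => pos μ p β τ t') (β.drop t') σ t = pos μ p β σ (t' + t) := by
  simp only [pos]
  rw [← act_append, ← List.take_add]

/-- Positions of the reversed strand, rooted at the endpoint: time runs backwards. -/
theorem pos_reverse (μ : Fin 3 → Equiv.Perm (Fin n)) (hμ : ∀ c, μ c * μ c = 1) (p : Bool → Fin n)
    (β : List (Fin 3)) (σ : Bool) (t : ℕ) :
    pos μ (fun τ => pos μ p β τ β.length) β.reverse σ t = pos μ p β σ (β.length - t) := by
  simp only [pos, List.take_length, act]
  exact SameColourTip.foldl_reverse_take μ hμ β t (p σ)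

/-! ### The absorbing-set hypothesis -/

section
variable (μ : Fin 3 → Equiv.Perm (Fin n)) (F : Finset (Fin n)) (r : ℕ)

/-- The hypothesis on the absorbing set used throughout: outside `F` there is no nonempty reduced closed walk of
length `≤ 2r` (i.e. `F ⊇ F_cyc(2r)`). -/
def NoShortCycleOutside : Prop :=
  ∀ y ∉ F, ∀ w : List (Fin 3), w ≠ [] → List.IsChain (· ≠ ·) w → w.length ≤ 2 * r → act μ y w ≠ y

end

/-! ### Distinct legs close a reduced walk -/

/-- Two DISTINCT reduced words with the same endpoint from `y` leave a nonempty REDUCED closed walk of length at most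
`|P| + |P'|` at that endpoint (strip the longest common prefix, read one leg backwards). -/
theorem closed_reduced_of_ne (μ : Fin 3 → Equiv.Perm (Fin n)) (hμ : ∀ c, μ c * μ c = 1) :
    ∀ (P P' : List (Fin 3)) (y : Fin n), P ≠ P' → List.IsChain (· ≠ ·) P → List.IsChain (· ≠ ·) P' →
      act μ y P = act μ y P' →
      ∃ w : List (Fin 3), w ≠ [] ∧ List.IsChain (· ≠ ·) w ∧ w.length ≤ P.length + P'.length ∧
        act μ (act μ y P) w = act μ y P := by
  intro P
  induction P with
  | nil =>
    intro P' y hne _ hc' he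
    refine ⟨P', fun h => hne h.symm, hc', by simp, ?_⟩
    simp only [act, List.foldl_nil] at he ⊢
    exact he.symm
  | cons c P ih =>
    intro P' y hne hc hc' he
    cases P' with
    | nil =>
      refine ⟨(c :: P).reverse, by simp, List.isChain_reverse.mpr (hc.imp fun a b h => Ne.symm h), by simp, ?_⟩
      rw [act_act_reverse μ (involutive_of_mul_self μ hμ)]
      simp only [act, List.foldl_nil] at he
      exact he.symm
    | cons c' P' =>
      by_cases hcc : c = c'
      · subst hcc
        have hne' : P ≠ P' := fun h => hne (by rw [h])
        have he' : act μ (μ c y) P = act μ (μ c y) P' := by simpa [act] using he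
        obtain ⟨w, h1, h2, h3, h4⟩ := ih P' (μ c y) hne' hc.tail hc'.tail he'
        refine ⟨w, h1, h2, by simp; omega, ?_⟩
        simpa [act] using h4
      · refine ⟨(c :: P).reverse ++ (c' :: P'), by simp,
          ?_, by simp; omega, ?_⟩
        · rw [List.isChain_append]
          refine ⟨List.isChain_reverse.mpr (hc.imp fun a b h => Ne.symm h), hc', ?_⟩
          intro a ha b hb
          rw [List.getLast?_reverse, List.head?_cons, Option.mem_def, Option.some.injEq] at ha
          rw [List.head?_cons, Option.mem_def, Option.some.injEq] at hb
          rw [← ha, ← hb]; exact hcc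
        · rw [act_append, act_act_reverse μ (involutive_of_mul_self μ hμ)]
          exact he.symm

end CleanPair

open TwinSupplyCS CleanPair in
/-- **`stub_closedReducedOfNe`** (registered sub-goal of stmt-MatrixMultiplication-10883, tree vocabulary): two distinct reduced
colour words with the same endpoint from `y` leave a nonempty REDUCED closed walk of length `≤ |P| + |P'|` at that endpoint —
the engine of corner exclusion in the depth recursion. -/
theorem stub_closedReducedOfNe : ∀ (n : ℕ) (μ : Fin 3 → Equiv.Perm (Fin n)) (P P' : List (Fin 3)) (y : Fin n), (∀ c, μ c * μ c = 1) → P ≠ P' → List.IsChain (· ≠ ·) P → List.IsChain (· ≠ ·) P' → P.foldl (fun v c => μ c v) y = P'.foldl (fun v c => μ c v) y → ∃ w : List (Fin 3), w ≠ [] ∧ List.IsChain (· ≠ ·) w ∧ w.length ≤ P.length + P'.length ∧ w.foldl (fun v c => μ c v) (P.foldl (fun v c => μ c v) y) = P.foldl (fun v c => μ c v) y :=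
  fun _ μ P P' y hμ hne hc hc' he => closed_reduced_of_ne μ hμ P P' y hne hc hc' he

end Summit.MatrixMultiplication.MatrixMultiplication.Theorems.HyperoctahedralThreshold
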